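/-
Copyright: the b2b-balaban T⁴-continuum CRUX team, row NE7b OWNER lineage `t4-ne7b-p1` (gen 131). Project licence.
-/
import Summits.QuantumFields.BalabanUV.T4Continuum.Spine.NE7b.SupPolymerLocalResummation

/-!
# THE RESUMMED ACTIVITY OF A POLYMER-LOCAL GAS IS SMALL LIKE `ε′^{#Y}` — THE COVER-COUNTING BOUND: if the activities of the
# touch-connected families satisfy `|M(𝒜)| ≤ ∏_{X∈𝒜} ε^{#X}` (`0 ≤ ε ≤ 1`; e.g. regulated set factors `‖f_X‖ ≲ ε^{#X}`) and the members of
# `𝒳` are nonempty `R`-connected cell sets of a cell graph with `≤ Δ` neighbours, then the activity of (349)'s resummed gas obeys, for EVERY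
# cell set `Y` and uniformly in `𝒳`,
#   `|(⋃_*M)(Y)| ≤ (√ε)^{#Y}·∏_{X∈𝒳, X⊆Y}(1 + (√ε)^{#X}) ≤ (√ε)^{#Y}·exp(Σ_{X∈𝒳, X⊆Y}(√ε)^{#X}) ≤ (√ε·e^{2√ε})^{#Y}`
# whenever `(Δ+1)²√ε ≤ ½` (every cover `𝒜` of `Y` has `Σ_{X∈𝒜}#X ≥ #Y`, so half of the smallness pays `(√ε)^{#Y}` and the other half is
# summed freely over sub-families, `∏(1 + a_X)`; the lattice-animal sum `Σ_{X∋p}(√ε)^{#X} ≤ 2√ε` is the tree's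
# `sum_pow_card_le_of_connected`) — so (287)'s bounded-degree Kotecký–Preiss layer applies to the polymer-local input class with
# `ε′ = √ε·e^{2√ε}`: SCOPING-d5 (3b) DISCHARGED (row NE7b, node U5c; (349) + the tree's `sum_pow_card_le_of_connected`, Mathlib's
# `Finset.prod_one_add` BY NAME; [folklore])

Cell `pub-balaban`, sub-cell `t4`, spine estimate NE7b (`T4WeightBudget.RelWeightBound`; the cell's OWN estimate — NOT PRINTED in
[Bałaban 1983–89], NOT PROVED).  Crux-route work under `Spine/NE7b/` by the row OWNER (`t4-ne7b-p1` gen 131, file (350)) under FREEZE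
(0)'s crux-prover clause, on `g131/records/SCOPING-d5-reentry.md` DECISION (3b); NOTHING of Bałaban's is named as a Lean object, valued or
asserted; no `T4Continuum/Support` leaf typed; no `def`, no notation; zero `sorry`.  Imports (BY NAME): the OWNER's (349)
`…SupPolymerLocalResummation`; the tree's `pushforwardActivity`, `rconnSubsets`, `mem_rconnSubsets`, `IsRConnected`,
`PolymerGasGeometric.sum_pow_card_le_of_connected`; Mathlib's `Finset.prod_one_add`, `Real.exp_sum`, `Real.add_one_le_exp`, `card_biUnion_le`.

WHAT IS PROVED ([folklore]):
* §1 `card_le_sum_card_of_biUnion_eq` (a cover of `Y` has total size `≥ #Y`), `pow_totalsize_le` (`∏_{X∈𝒜}ε^{#X} ≤ (√ε)^{#Y}∏_{X∈𝒜}(√ε)^{#X}`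
  for covers), `sum_prod_le_exp_sum` (`Σ_{𝒜 ⊆ 𝒳_Y}∏_{X∈𝒜}a_X = ∏_{X∈𝒳_Y}(1 + a_X) ≤ exp(Σ a_X)` for `a ≥ 0`),
  `sum_pow_le_two_mul_card` (`Σ_{X∈𝒳, X⊆Y}λ^{#X} ≤ 2λ·#Y` by the lattice-animal bound at each cell of `Y`);
* §2 THE END **`abs_pushforwardActivity_le`** (`|(⋃_*M)(Y)| ≤ (√ε·exp(2√ε))^{#Y}` under `(Δ+1)²√ε ≤ ½`); §3 toy.

HONEST (what this is NOT).  Combinatorics; with (348)∕(349) the polymer-local input class now meets EVERY hypothesis shape of (287)'s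
activity-level layer (`hact : ‖activity(K)‖ ≤ ε′^{#K}` on `R`-connected cell sets) — the regulated-factor estimate `|M(𝒜)| ≤ ∏ε^{#X}` for the
road's set factors `e^{−K_X} − 1` ((289)'s Gaussian-regulator pattern) and the re-run of (296)∕(311)∕(312) on the resummed gas are the
successor's; scalar skeleton ((A3), NC-NE7b-α UNRULED); nothing of Bałaban's asserted.  BY-NAME EFFECT ON THE WALL: NONE.  NE7b NOT PRINTED ∕
NOT PROVED; spine PROVED 0∕9; rung (B)+1 — the programme's measures remain FINITE-torus statements; NOT the mass gap, NOT Clay.  HONEST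
DEPENDENCY: continuum YM on T⁴ ⇐ BetaPertH ∧ nine spine estimates (0∕9 proved); BetaPertH ⇐ (D1) ∧ (D4) ∧ CAP+tail; G-an2-4 gates asym,
D1 and NE2∕3∕4.
-/

set_option autoImplicit false

noncomputable section

namespace Summit.QuantumFields.BalabanUV.T4Continuum.NE7b.SupPolymerLocalSmallness

open Finset Real
open scoped BigOperators
open Literature.Probability.LatticeModels

variable {V : Type*} [DecidableEq V] {R : V → V → Prop}

/-! ## §1. Covers, half-powers, free sums, lattice animals -/

/-- A cover of `Y` has total size at least `#Y`. [folklore] -/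
theorem card_le_sum_card_of_biUnion_eq {𝒜 : Finset (Finset V)} {Y : Finset V} (hU : 𝒜.biUnion id = Y) :
    Y.card ≤ ∑ X ∈ 𝒜, X.card := by
  rw [← hU]
  exact card_biUnion_le

/-- **Half of the smallness pays for the support**: `0 ≤ ε ≤ 1`, `⋃𝒜 = Y` ⟹ `∏_{X∈𝒜}ε^{#X} ≤ (√ε)^{#Y}·∏_{X∈𝒜}(√ε)^{#X}`. [folklore] -/
theorem pow_totalsize_le {ε : ℝ} (hε0 : 0 ≤ ε) (hε1 : ε ≤ 1) {𝒜 : Finset (Finset V)} {Y : Finset V} (hU : 𝒜.biUnion id = Y) :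
    ∏ X ∈ 𝒜, ε ^ X.card ≤ Real.sqrt ε ^ Y.card * ∏ X ∈ 𝒜, Real.sqrt ε ^ X.card := by
  have hs0 : 0 ≤ Real.sqrt ε := Real.sqrt_nonneg ε
  have hs1 : Real.sqrt ε ≤ 1 := Real.sqrt_le_one.2 hε1
  have hε : ε = Real.sqrt ε * Real.sqrt ε := (Real.mul_self_sqrt hε0).symm
  have e1 : ∏ X ∈ 𝒜, ε ^ X.card = Real.sqrt ε ^ (∑ X ∈ 𝒜, X.card) * ∏ X ∈ 𝒜, Real.sqrt ε ^ X.card := by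
    rw [← prod_pow_eq_pow_sum, ← prod_mul_distrib]
    refine prod_congr rfl fun X _ => ?_
    rw [← mul_pow, ← hε]
  rw [e1]
  exact mul_le_mul_of_nonneg_right (pow_le_pow_of_le_one hs0 hs1 (card_le_sum_card_of_biUnion_eq hU))
    (prod_nonneg fun X _ => pow_nonneg hs0 _)

omit [DecidableEq V] in
/-- **The free sum over sub-families**: `a ≥ 0` ⟹ `Σ_{𝒜 ⊆ 𝒳'}∏_{X∈𝒜}a_X = ∏_{X∈𝒳'}(1 + a_X) ≤ exp(Σ_{X∈𝒳'}a_X)`. [folklore] -/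
theorem sum_prod_le_exp_sum (𝒳' : Finset (Finset V)) {a : Finset V → ℝ} (ha : ∀ X ∈ 𝒳', 0 ≤ a X) :
    ∑ 𝒜 ∈ 𝒳'.powerset, ∏ X ∈ 𝒜, a X ≤ Real.exp (∑ X ∈ 𝒳', a X) := by
  rw [← prod_one_add, Real.exp_sum]
  exact prod_le_prod (fun X hX => by linarith [ha X hX]) fun X _ => by linarith [Real.add_one_le_exp (a X)]

/-- **The lattice-animal sum over the members inside `Y`**: `R` symmetric with `≤ Δ` neighbours, members nonempty `R`-connected,
`(Δ+1)²λ ≤ ½`, `λ ≥ 0` ⟹ `Σ_{X∈𝒳, X⊆Y}λ^{#X} ≤ 2λ·#Y` (each member contains a cell of `Y`; at each cell the tree's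
`sum_pow_card_le_of_connected`). [folklore] -/
theorem sum_pow_le_two_mul_card (hR : ∀ x y, R x y → R y x) {nbr : V → Finset V} {Δ : ℕ} (hΔ : ∀ x, (nbr x).card ≤ Δ)
    (hnbr : ∀ x y, R x y → y ∈ nbr x) {lam : ℝ} (hlam : 0 ≤ lam) (hsmall : ((Δ : ℝ) + 1) ^ 2 * lam ≤ 1 / 2)
    (𝒳 : Finset (Finset V)) (hconn : ∀ X ∈ 𝒳, IsRConnected R X) (Y : Finset V) :
    ∑ X ∈ 𝒳.filter (fun X => X ⊆ Y), lam ^ X.card ≤ 2 * lam * Y.card := by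
  -- overcount: each member inside `Y` is counted at each of its (≥ 1) cells
  have h1 : ∑ X ∈ 𝒳.filter (fun X => X ⊆ Y), lam ^ X.card ≤
      ∑ X ∈ 𝒳.filter (fun X => X ⊆ Y), ∑ p ∈ Y, if p ∈ X then lam ^ X.card else 0 := by
    refine sum_le_sum fun X hX => ?_
    obtain ⟨hX𝒳, hXY⟩ := mem_filter.1 hX
    obtain ⟨p, hp⟩ := (hconn X hX𝒳).1
    rw [← sum_filter]
    have hpY : p ∈ Y.filter (fun q => q ∈ X) := mem_filter.2 ⟨hXY hp, hp⟩
    exact single_le_sum (f := fun _ => lam ^ X.card) (fun _ _ => pow_nonneg hlam _) hpY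
  refine h1.trans ?_
  rw [sum_comm]
  have h2 : ∀ p ∈ Y, (∑ X ∈ 𝒳.filter (fun X => X ⊆ Y), if p ∈ X then lam ^ X.card else 0) ≤ 2 * lam := fun p _ => by
    rw [← sum_filter]
    exact sum_pow_card_le_of_connected hR hΔ hnbr hlam hsmall p _ fun X hX => by
      obtain ⟨hX', hpX⟩ := mem_filter.1 hX
      exact ⟨hpX, hconn X (mem_filter.1 hX').1⟩
  calc ∑ p ∈ Y, ∑ X ∈ 𝒳.filter (fun X => X ⊆ Y), (if p ∈ X then lam ^ X.card else 0) ≤ ∑ _p ∈ Y, 2 * lam := sum_le_sum h2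
    _ = 2 * lam * Y.card := by rw [sum_const, nsmul_eq_mul]; ring

/-! ## §2. THE END: the resummed activity is small like `ε′^{#Y}` -/

/-- **THE COVER-COUNTING BOUND.**  `R` symmetric, decidable, with `≤ Δ` neighbours; `𝒳` a finite family of nonempty `R`-connected cell sets;
activities of the touch-connected families with `|M(𝒜)| ≤ ∏_{X∈𝒜}ε^{#X}` (`0 ≤ ε ≤ 1`); `(Δ+1)²√ε ≤ ½` ⟹ for every cell set `Y`:
`|(⋃_*M)(Y)| ≤ (√ε·exp(2√ε))^{#Y}` — the resummed activity of (349)'s gas is small like `ε′^{#Y}`, uniformly in `𝒳`. [folklore] -/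
theorem abs_pushforwardActivity_le [DecidableRel R] (hR : ∀ x y, R x y → R y x) {nbr : V → Finset V} {Δ : ℕ}
    (hΔ : ∀ x, (nbr x).card ≤ Δ) (hnbr : ∀ x y, R x y → y ∈ nbr x) (𝒳 : Finset (Finset V)) (hconn : ∀ X ∈ 𝒳, IsRConnected R X)
    {M : Finset (Finset V) → ℂ} {ε : ℝ} (hε0 : 0 ≤ ε) (hε1 : ε ≤ 1)
    (hM : ∀ 𝒜, 𝒜 ⊆ 𝒳 → ‖M 𝒜‖ ≤ ∏ X ∈ 𝒜, ε ^ X.card)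
    (hsmall : ((Δ : ℝ) + 1) ^ 2 * Real.sqrt ε ≤ 1 / 2) (Y : Finset V) :
    ‖pushforwardActivity (fun 𝒜 : Finset (Finset V) => 𝒜.biUnion id) M (rconnSubsets (Touches R) 𝒳) Y‖ ≤
      (Real.sqrt ε * Real.exp (2 * Real.sqrt ε)) ^ Y.card := by
  have hs0 : 0 ≤ Real.sqrt ε := Real.sqrt_nonneg ε
  set 𝒳Y := 𝒳.filter (fun X => X ⊆ Y) with h𝒳Y
  -- step 1: the fibre over `Y` sits inside the sub-families of the members inside `Y`
  have hsub : (rconnSubsets (Touches R) 𝒳).filter (fun 𝒜 => 𝒜.biUnion id = Y) ⊆ 𝒳Y.powerset := fun 𝒜 h𝒜 => by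
    obtain ⟨h𝒜P, hU⟩ := mem_filter.1 h𝒜
    have h𝒜𝒳 := (mem_rconnSubsets.1 h𝒜P).1
    refine mem_powerset.2 fun X hX => mem_filter.2 ⟨h𝒜𝒳 hX, ?_⟩
    rw [← hU]
    exact subset_biUnion_of_mem id hX
  -- step 2: the fibre sum with half of the smallness extracted
  rw [pushforwardActivity_apply]
  calc ‖∑ 𝒜 ∈ (rconnSubsets (Touches R) 𝒳).filter (fun 𝒜 => 𝒜.biUnion id = Y), M 𝒜‖
      ≤ ∑ 𝒜 ∈ (rconnSubsets (Touches R) 𝒳).filter (fun 𝒜 => 𝒜.biUnion id = Y), ‖M 𝒜‖ := norm_sum_le _ _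
    _ ≤ ∑ 𝒜 ∈ (rconnSubsets (Touches R) 𝒳).filter (fun 𝒜 => 𝒜.biUnion id = Y),
          Real.sqrt ε ^ Y.card * ∏ X ∈ 𝒜, Real.sqrt ε ^ X.card := by
        refine sum_le_sum fun 𝒜 h𝒜 => ?_
        obtain ⟨h𝒜P, hU⟩ := mem_filter.1 h𝒜
        exact (hM 𝒜 (mem_rconnSubsets.1 h𝒜P).1).trans (pow_totalsize_le hε0 hε1 hU)
    _ ≤ ∑ 𝒜 ∈ 𝒳Y.powerset, Real.sqrt ε ^ Y.card * ∏ X ∈ 𝒜, Real.sqrt ε ^ X.card :=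
        sum_le_sum_of_subset_of_nonneg hsub fun 𝒜 _ _ => mul_nonneg (pow_nonneg hs0 _) (prod_nonneg fun X _ => pow_nonneg hs0 _)
    _ = Real.sqrt ε ^ Y.card * ∑ 𝒜 ∈ 𝒳Y.powerset, ∏ X ∈ 𝒜, Real.sqrt ε ^ X.card := by rw [mul_sum]
    _ ≤ Real.sqrt ε ^ Y.card * Real.exp (∑ X ∈ 𝒳Y, Real.sqrt ε ^ X.card) :=
        mul_le_mul_of_nonneg_left (sum_prod_le_exp_sum 𝒳Y fun X _ => pow_nonneg hs0 _) (pow_nonneg hs0 _)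
    _ ≤ Real.sqrt ε ^ Y.card * Real.exp (2 * Real.sqrt ε * Y.card) :=
        mul_le_mul_of_nonneg_left (Real.exp_le_exp.2 (sum_pow_le_two_mul_card hR hΔ hnbr hs0 hsmall 𝒳 hconn Y)) (pow_nonneg hs0 _)
    _ = (Real.sqrt ε * Real.exp (2 * Real.sqrt ε)) ^ Y.card := by
        rw [mul_pow, ← Real.exp_nat_mul]
        congr 1
        congr 1
        ring

/-! ## §3. Toy -/

/-- Toy (§1): the one-member cover `{{0,1}}` of `{0,1}` has total size `2 ≥ 2`. -/
example : (({0, 1} : Finset (Fin 2))).card ≤ ∑ X ∈ ({{0, 1}} : Finset (Finset (Fin 2))), X.card :=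
  card_le_sum_card_of_biUnion_eq (by simp)

end Summit.QuantumFields.BalabanUV.T4Continuum.NE7b.SupPolymerLocalSmallness
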